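import Literature.Algebra.Homology.ExtOfAcyclicResolutionFunctoriality
import HarnessLib

/-!
# Naturality of `Extⁿ(X, M) ≅ Hⁿ(Ext⁰(X, I•))` in the FIRST variable `X`

Topic `Algebra/Homology`; namespace `Literature.Algebra.Homology.AcyclicResolution`.  Sequel of
`ExtOfAcyclicResolution` (door-c4 g13: the isomorphisms `extAddEquivHomologyZero/Succ`),
`ExtOfAcyclicResolutionNaturality` (naturality in the resolution `(M, I)`) and
`ExtOfAcyclicResolutionFunctoriality` (§1 there: the concrete homology map `kerQuotMapOf ψ` of an arbitrary
cochain map `ψ` of complexes of abelian groups, `homologyMap_concreteOf`); pure homological algebra, one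
plumbing definition (the cochain map `Ext⁰(g, I•)`), no named fact, no instance, no `sorry`.

For a morphism `g : X' ⟶ X` and ONE exact augmented complex `0 → M —η→ I•` whose terms are acyclic for both
`Ext(X, –)` and `Ext(X', –)`, precomposition `g^* : Extⁿ(X, M) → Extⁿ(X', M)` (`x ↦ [g] ∘ x`) corresponds,
under `extAddEquivHomologyZero/Succ`, to `Hⁿ` of the cochain map `g^* : Ext⁰(X, I•) → Ext⁰(X', I•)`
(`extComplexPrecomp g I`, Mathlib's bifunctor `Abelian.extFunctor 0` in its contravariant variable).  Every
step of the dimension-shifting construction is a post-composition (`x ↦ x ∘ [S]`, `x ↦ x ∘ ι`, `x ↦ x ∘ e`),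
which commutes with the pre-composition `x ↦ [g] ∘ x` by the associativity of the Yoneda composition
(`Ext.comp_assoc`); the homology side is `homologyMap_concreteOf`.

Main results: **`extAddEquivHomologySucc_precomp`**, **`extAddEquivHomologyZero_precomp`**.  Written for
the background lane «PT-Ш-S-TC» of crux `stmt-BirchSwinnertonDyer-19032` (cell bsd-eis, seat bsd-line-x1-p1-w7
gen 12): it is the engine half of the naturality IN THE MODULE `N` of the comparison
`Extⁿ_{C_Γ}(N, X) ≃ Hⁿ_cont(Γ, Hom(N, X))` (Harari Prop. 16.16 / Lemma 17.21 (a)), i.e. of the hypothesis `hcmpG`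
of `ShaExtRoad.pairing_natural` on Milne's `Ext` road to the `S`-restricted `Ш`-pairing.  HONEST FRAMING:
homological algebra only; nothing arithmetic is proved here.  AI formalisation, established only by the kernel
check.

## References
* C. A. Weibel, *An introduction to homological algebra*, CUP (1994), §2.4 (dimension shifting, Exercise 2.4.3),
  §2.7 (balancing / naturality of `Ext`). [Weibel1994]
* D. Harari, *Galois Cohomology and Class Field Theory* (2020), §16.2 (16.4) (functoriality of `Ext` pairings). [Harari2020]
-/

noncomputable section

universe w v u

namespace Literature.Algebra.Homology

namespace AcyclicResolution

open CategoryTheory CategoryTheory.Limits CategoryTheory.Abelian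

variable {C : Type u} [Category.{v} C] [Abelian C] [HasExt.{w} C]

/-- Unfolding of Mathlib's `Ext.postcomp`. [folklore] -/
private theorem postcomp_apply'' (X : C) {Y Z : C} {n a b : ℕ} (β : Ext Y Z n) (h : a + n = b)
    (x : Ext X Y a) : β.postcomp X h x = x.comp β h := rfl

/-- Associativity with a degree-`0` class on the left: `([g] ∘ x) ∘ β = [g] ∘ (x ∘ β)`. [cite: Weibel1994, §2.7] -/
theorem mk₀_comp_comp {X' X Y Z : C} (g : X' ⟶ X) {a b c : ℕ} (x : Ext X Y a) (β : Ext Y Z b)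
    (h : a + b = c) :
    ((Ext.mk₀ g).comp x (zero_add a)).comp β h = (Ext.mk₀ g).comp (x.comp β h) (zero_add c) :=
  Ext.comp_assoc _ _ _ (zero_add a) h (by omega)

/-! ## §1 One step: the dimension shift commutes with pre-composition -/

section OneStep

variable {X X' : C} (g : X' ⟶ X) {S : ShortComplex C} (hS : S.ShortExact)

/-- `shiftAddEquiv` commutes with `g^*`. [cite: Weibel1994, §2.4 (dimension shifting, Exercise 2.4.3)] -/
theorem shiftAddEquiv_precomp {a b : ℕ} (h : a + 1 = b)
    (ha : ∀ e : Ext X S.X₂ a, e = 0) (hb : ∀ e : Ext X S.X₂ b, e = 0)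
    (ha' : ∀ e : Ext X' S.X₂ a, e = 0) (hb' : ∀ e : Ext X' S.X₂ b, e = 0) (x : Ext X S.X₃ a) :
    shiftAddEquiv X' hS h ha' hb' ((Ext.mk₀ g).comp x (zero_add a)) =
      (Ext.mk₀ g).comp (shiftAddEquiv X hS h ha hb x) (zero_add b) := by
  rw [shiftAddEquiv_apply, shiftAddEquiv_apply, mk₀_comp_comp]

/-- `extOneQuotientAddEquiv` commutes with `g^*`: the class of `δ y` goes to the class of `[g] ∘ y`.
[cite: Weibel1994, §2.4 (dimension shifting, Exercise 2.4.3)] -/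
theorem extOneQuotientAddEquiv_precomp (h1 : ∀ e : Ext X S.X₂ 1, e = 0) (h1' : ∀ e : Ext X' S.X₂ 1, e = 0)
    (x : Ext X S.X₁ 1) :
    QuotientAddGroup.map _ _ (((extFunctor 0).map g.op).app S.X₃).hom
        (fun y hy => by
          obtain ⟨z, rfl⟩ := hy
          refine ⟨(Ext.mk₀ g).comp z (zero_add 0), ?_⟩
          rw [postcomp_apply'', postcomp_apply'', mk₀_comp_comp]
          rfl)
        (extOneQuotientAddEquiv X hS h1 x) =
      extOneQuotientAddEquiv X' hS h1' ((Ext.mk₀ g).comp x (zero_add 1)) := by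
  obtain ⟨y, rfl⟩ := extClass_postcomp_surjective X hS (zero_add 1) h1 x
  have e₁ : extOneQuotientAddEquiv X hS h1 (hS.extClass.postcomp X (zero_add 1) y) =
      QuotientAddGroup.mk y :=
    (AddEquiv.apply_eq_iff_symm_apply _).2 (extOneQuotientAddEquiv_symm_mk X hS h1 y).symm
  have e₂ : (Ext.mk₀ g).comp (hS.extClass.postcomp X (zero_add 1) y) (zero_add 1) =
      hS.extClass.postcomp X' (zero_add 1) ((Ext.mk₀ g).comp y (zero_add 0)) := by
    rw [postcomp_apply'', postcomp_apply'', mk₀_comp_comp]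
  have e₃ : extOneQuotientAddEquiv X' hS h1'
      (hS.extClass.postcomp X' (zero_add 1) ((Ext.mk₀ g).comp y (zero_add 0))) =
      QuotientAddGroup.mk ((Ext.mk₀ g).comp y (zero_add 0)) :=
    (AddEquiv.apply_eq_iff_symm_apply _).2 (extOneQuotientAddEquiv_symm_mk X' hS h1' _).symm
  rw [e₁, e₂, e₃]
  rfl

end OneStep

/-! ## §2 The iterated shift and the cycle isomorphism commute with pre-composition -/

section Cycles

variable {X X' : C} (g : X' ⟶ X) (I : CochainComplex C ℕ)

/-- **`iterShift` commutes with `g^*`.** [cite: Weibel1994, §2.4 (dimension shifting, Exercise 2.4.3)] -/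
theorem iterShift_precomp (hI : ∀ n, I.ExactAt (n + 1)) (hX : ∀ n q (e : Ext X (I.X n) (q + 1)), e = 0)
    (hX' : ∀ n q (e : Ext X' (I.X n) (q + 1)), e = 0) :
    ∀ (n : ℕ) {a b : ℕ} (h : a + 1 + n = b) (x : Ext X (I.cycles n) (a + 1)),
      iterShift I X' hI hX' n h ((Ext.mk₀ g).comp x (zero_add _)) =
        (Ext.mk₀ g).comp (iterShift I X hI hX n h x) (zero_add b)
  | 0, a, b, h, x => by
    subst h
    rw [iterShift_zero_apply, iterShift_zero_apply]
  | n + 1, a, b, h, x => by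
    rw [iterShift_succ_apply, iterShift_succ_apply,
      shiftAddEquiv_precomp g (cyclesSC_shortExact I n (hI n)), iterShift_precomp hI hX hX' n]

/-- `iterShift⁻¹` commutes with `g^*`. [cite: Weibel1994, §2.4 (dimension shifting, Exercise 2.4.3)] -/
theorem iterShift_symm_precomp (hI : ∀ n, I.ExactAt (n + 1))
    (hX : ∀ n q (e : Ext X (I.X n) (q + 1)), e = 0) (hX' : ∀ n q (e : Ext X' (I.X n) (q + 1)), e = 0)
    (n : ℕ) {a b : ℕ} (h : a + 1 + n = b) (z : Ext X (I.cycles 0) b) :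
    (iterShift I X' hI hX' n h).symm ((Ext.mk₀ g).comp z (zero_add b)) =
      (Ext.mk₀ g).comp ((iterShift I X hI hX n h).symm z) (zero_add _) := by
  apply (iterShift I X' hI hX' n h).injective
  rw [AddEquiv.apply_symm_apply, iterShift_precomp g I hI hX hX' n h, AddEquiv.apply_symm_apply]

/-- `extAddEquivOfIso` commutes with `g^*`. [cite: Weibel1994, §2.7] -/
theorem extAddEquivOfIso_precomp {Y Y' : C} (e : Y ≅ Y') (n : ℕ) (x : Ext X Y n) :
    extAddEquivOfIso X' e n ((Ext.mk₀ g).comp x (zero_add n)) =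
      (Ext.mk₀ g).comp (extAddEquivOfIso X e n x) (zero_add n) := by
  rw [extAddEquivOfIso_apply, extAddEquivOfIso_apply, mk₀_comp_comp]

/-- `cyclesExtAddEquiv` commutes with `g^*` (on underlying elements).
[cite: Weibel1994, §2.4 (dimension shifting, Exercise 2.4.3)] -/
theorem cyclesExtAddEquiv_precomp (i j k : ℕ) (hjk : (ComplexShape.up ℕ).next j = k)
    (x : Ext X (I.cycles j) 0) :
    (cyclesExtAddEquiv X' I i j k hjk ((Ext.mk₀ g).comp x (zero_add 0))).1 =
      (Ext.mk₀ g).comp (cyclesExtAddEquiv X I i j k hjk x).1 (zero_add 0) := by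
  rw [cyclesExtAddEquiv_apply_val, cyclesExtAddEquiv_apply_val, mk₀_comp_comp]

end Cycles

/-! ## §3 The cochain map `g^* : Ext⁰(X, I•) → Ext⁰(X', I•)` -/

section Complex

variable {X X' : C}

/-- **The cochain map `Ext⁰(X, I•) → Ext⁰(X', I•)` induced by `g : X' ⟶ X`** (`x ↦ [g] ∘ x` termwise —
Mathlib's bifunctor `extFunctor 0` in its first variable; a cochain map by associativity of the Yoneda
composition). [cite: Weibel1994, §2.7] -/
def extComplexPrecomp (g : X' ⟶ X) (I : CochainComplex C ℕ) : extComplex X I ⟶ extComplex X' I where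
  f n := AddCommGrpCat.ofHom (AddMonoidHom.mk' (fun x : Ext X (I.X n) 0 => (Ext.mk₀ g).comp x (zero_add 0))
    (fun x y => Ext.comp_add _ _ _ _))
  comm' i j _ := by
    ext x
    change ((Ext.mk₀ g).comp x (zero_add 0)).comp (Ext.mk₀ (I.d i j)) (add_zero 0) =
      (Ext.mk₀ g).comp (x.comp (Ext.mk₀ (I.d i j)) (add_zero 0)) (zero_add 0)
    rw [mk₀_comp_comp]

/-- Componentwise formula: `(g^*)ⁿ x = [g] ∘ x`. [cite: Weibel1994, §2.7] -/
@[simp]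
theorem extComplexPrecomp_f_apply (g : X' ⟶ X) (I : CochainComplex C ℕ) (n : ℕ) (x : Ext X (I.X n) 0) :
    ((extComplexPrecomp g I).f n).hom x = (Ext.mk₀ g).comp x (zero_add 0) := rfl

end Complex

/-! ## §4 Naturality of the main isomorphisms in `X` -/

section Main

variable {X X' : C} (g : X' ⟶ X) (I : CochainComplex C ℕ)
  {M : C} (η : M ⟶ I.X 0) (hη : η ≫ I.d 0 1 = 0) (hex : (ShortComplex.mk η (I.d 0 1) hη).Exact)
  (hI : ∀ n, I.ExactAt (n + 1)) (hX : ∀ n q (e : Ext X (I.X n) (q + 1)), e = 0)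
  (hX' : ∀ n q (e : Ext X' (I.X n) (q + 1)), e = 0)

/-- **Naturality of `extAddEquivHomologySucc` in `X`**: for `g : X' ⟶ X` and an exact augmented complex
`0 → M —η→ I•` whose terms are acyclic for `Ext(X, –)` and `Ext(X', –)`, the isomorphisms
`Extⁿ⁺¹(·, M) ≃+ Hⁿ⁺¹(Ext⁰(·, I•))` intertwine `g^*` with `Hⁿ⁺¹(g^*)`.
[cite: Weibel1994, §2.4 (dimension shifting, Exercise 2.4.3), §2.7] -/
theorem extAddEquivHomologySucc_precomp [Mono η] (n : ℕ) (x : Ext X M (n + 1)) :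
    (HomologicalComplex.homologyMap (extComplexPrecomp g I) (n + 1)).hom
        (extAddEquivHomologySucc X I η hη hex hI hX n x) =
      extAddEquivHomologySucc X' I η hη hex hI hX' n ((Ext.mk₀ g).comp x (zero_add _)) := by
  -- abbreviations for the concrete isomorphisms `H ≅ ker/Im`
  set e5 := ((extComplex X I).homologyIsoSc' n (n + 1) (n + 1 + 1) (CochainComplex.prev_nat_succ n)
      (CochainComplex.next ℕ (n + 1)) ≪≫ ShortComplex.abHomologyIso _) with he5
  set e5' := ((extComplex X' I).homologyIsoSc' n (n + 1) (n + 1 + 1) (CochainComplex.prev_nat_succ n)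
      (CochainComplex.next ℕ (n + 1)) ≪≫ ShortComplex.abHomologyIso _) with he5'
  -- it suffices to check after applying `e5'`
  apply e5'.addCommGroupIsoToAddEquiv.injective
  have hnat := homologyMap_concreteOf (extComplexPrecomp g I) n (n + 1) (n + 1 + 1)
    (CochainComplex.prev_nat_succ n) (CochainComplex.next ℕ (n + 1))
  have step5 : e5'.addCommGroupIsoToAddEquiv ((HomologicalComplex.homologyMap (extComplexPrecomp g I)
      (n + 1)).hom (extAddEquivHomologySucc X I η hη hex hI hX n x)) =
      kerQuotMapOf (extComplexPrecomp g I) n (n + 1) (n + 1 + 1) (e5.addCommGroupIsoToAddEquiv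
        (extAddEquivHomologySucc X I η hη hex hI hX n x)) := by
    change (HomologicalComplex.homologyMap (extComplexPrecomp g I) (n + 1) ≫ e5'.hom).hom _ =
      (e5.hom ≫ AddCommGrpCat.ofHom (kerQuotMapOf (extComplexPrecomp g I) n (n + 1) (n + 1 + 1))).hom _
    rw [hnat]
  rw [step5]
  -- unfold the definition of `extAddEquivHomologySucc` on both sides
  change kerQuotMapOf (extComplexPrecomp g I) n (n + 1) (n + 1 + 1) (e5.addCommGroupIsoToAddEquiv
      (e5.addCommGroupIsoToAddEquiv.symm
      (QuotientAddGroup.congr _ _ (cyclesExtAddEquiv X I n (n + 1) (n + 1 + 1) (CochainComplex.next ℕ (n + 1)))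
        (map_cyclesExtAddEquiv_range X I n)
        (extOneQuotientAddEquiv X (cyclesSC_shortExact I n (hI n)) (hX n 0)
          ((iterShift I X hI hX n (a := 0) (b := n + 1) (by omega)).symm
            (extAddEquivOfIso X (isoCyclesZero I η hη hex) (n + 1) x)))))) =
    e5'.addCommGroupIsoToAddEquiv (e5'.addCommGroupIsoToAddEquiv.symm
      (QuotientAddGroup.congr _ _ (cyclesExtAddEquiv X' I n (n + 1) (n + 1 + 1) (CochainComplex.next ℕ (n + 1)))
        (map_cyclesExtAddEquiv_range X' I n)
        (extOneQuotientAddEquiv X' (cyclesSC_shortExact I n (hI n)) (hX' n 0)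
          ((iterShift I X' hI hX' n (a := 0) (b := n + 1) (by omega)).symm
            (extAddEquivOfIso X' (isoCyclesZero I η hη hex) (n + 1) ((Ext.mk₀ g).comp x (zero_add _)))))))
  rw [AddEquiv.apply_symm_apply, AddEquiv.apply_symm_apply]
  -- step 1 + 2: push `g` through the cycle iso and the iterated shift
  have step12 : (iterShift I X' hI hX' n (a := 0) (b := n + 1) (by omega)).symm
      (extAddEquivOfIso X' (isoCyclesZero I η hη hex) (n + 1) ((Ext.mk₀ g).comp x (zero_add _))) =
      (Ext.mk₀ g).comp ((iterShift I X hI hX n (a := 0) (b := n + 1) (by omega)).symm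
        (extAddEquivOfIso X (isoCyclesZero I η hη hex) (n + 1) x)) (zero_add _) := by
    rw [extAddEquivOfIso_precomp, iterShift_symm_precomp g I hI hX hX']
  rw [step12]
  -- step 3: the bottom quotient
  set y := (iterShift I X hI hX n (a := 0) (b := n + 1) (by omega)).symm
    (extAddEquivOfIso X (isoCyclesZero I η hη hex) (n + 1) x) with hy
  have step3 := extOneQuotientAddEquiv_precomp g (cyclesSC_shortExact I n (hI n)) (hX n 0) (hX' n 0) y
  rw [← step3]
  -- step 4: the two quotient maps agree on representatives
  obtain ⟨z, hz⟩ := QuotientAddGroup.mk_surjective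
    (extOneQuotientAddEquiv X (cyclesSC_shortExact I n (hI n)) (hX n 0) y)
  rw [← hz]
  change QuotientAddGroup.mk (kerMapOf (extComplexPrecomp g I) n (n + 1) (n + 1 + 1)
      (cyclesExtAddEquiv X I n (n + 1) (n + 1 + 1) (CochainComplex.next ℕ (n + 1)) z)) =
    QuotientAddGroup.mk (cyclesExtAddEquiv X' I n (n + 1) (n + 1 + 1) (CochainComplex.next ℕ (n + 1))
      ((((extFunctor 0).map g.op).app (cyclesSC I n).X₃).hom z))
  congr 1
  apply Subtype.ext
  rw [kerMapOf_apply_val, extComplexPrecomp_f_apply]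
  exact (cyclesExtAddEquiv_precomp g I n (n + 1) (n + 1 + 1) (CochainComplex.next ℕ (n + 1)) z).symm

/-- **Naturality of `extAddEquivHomologyZero` in `X`.** [cite: Weibel1994, §2.4 (dimension shifting, Exercise 2.4.3), §2.7] -/
theorem extAddEquivHomologyZero_precomp [Mono η] (x : Ext X M 0) :
    (HomologicalComplex.homologyMap (extComplexPrecomp g I) 0).hom
        (extAddEquivHomologyZero X I η hη hex x) =
      extAddEquivHomologyZero X' I η hη hex ((Ext.mk₀ g).comp x (zero_add _)) := by
  set e5 := ((extComplex X I).homologyIsoSc' 0 0 1 CochainComplex.prev_nat_zero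
      (CochainComplex.next ℕ 0) ≪≫ ShortComplex.abHomologyIso _) with he5
  set e5' := ((extComplex X' I).homologyIsoSc' 0 0 1 CochainComplex.prev_nat_zero
      (CochainComplex.next ℕ 0) ≪≫ ShortComplex.abHomologyIso _) with he5'
  apply e5'.addCommGroupIsoToAddEquiv.injective
  have hnat := homologyMap_concreteOf (extComplexPrecomp g I) 0 0 1 CochainComplex.prev_nat_zero
    (CochainComplex.next ℕ 0)
  have step5 : e5'.addCommGroupIsoToAddEquiv ((HomologicalComplex.homologyMap (extComplexPrecomp g I) 0).hom
      (extAddEquivHomologyZero X I η hη hex x)) =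
      kerQuotMapOf (extComplexPrecomp g I) 0 0 1
        (e5.addCommGroupIsoToAddEquiv (extAddEquivHomologyZero X I η hη hex x)) := by
    change (HomologicalComplex.homologyMap (extComplexPrecomp g I) 0 ≫ e5'.hom).hom _ =
      (e5.hom ≫ AddCommGrpCat.ofHom (kerQuotMapOf (extComplexPrecomp g I) 0 0 1)).hom _
    rw [hnat]
  rw [step5]
  change kerQuotMapOf (extComplexPrecomp g I) 0 0 1 (e5.addCommGroupIsoToAddEquiv
      (e5.addCommGroupIsoToAddEquiv.symm
      (QuotientAddGroup.quotientAddEquivOfEq (abToCycles_zero_range_eq_bot X I).symm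
        (QuotientAddGroup.quotientBot.symm
          (cyclesExtAddEquiv X I 0 0 1 (CochainComplex.next ℕ 0)
            (extAddEquivOfIso X (isoCyclesZero I η hη hex) 0 x)))))) =
    e5'.addCommGroupIsoToAddEquiv (e5'.addCommGroupIsoToAddEquiv.symm
      (QuotientAddGroup.quotientAddEquivOfEq (abToCycles_zero_range_eq_bot X' I).symm
        (QuotientAddGroup.quotientBot.symm
          (cyclesExtAddEquiv X' I 0 0 1 (CochainComplex.next ℕ 0)
            (extAddEquivOfIso X' (isoCyclesZero I η hη hex) 0 ((Ext.mk₀ g).comp x (zero_add _)))))))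
  rw [AddEquiv.apply_symm_apply, AddEquiv.apply_symm_apply, extAddEquivOfIso_precomp]
  change QuotientAddGroup.mk (kerMapOf (extComplexPrecomp g I) 0 0 1
      (cyclesExtAddEquiv X I 0 0 1 (CochainComplex.next ℕ 0)
        (extAddEquivOfIso X (isoCyclesZero I η hη hex) 0 x))) =
    QuotientAddGroup.mk (cyclesExtAddEquiv X' I 0 0 1 (CochainComplex.next ℕ 0)
      ((Ext.mk₀ g).comp (extAddEquivOfIso X (isoCyclesZero I η hη hex) 0 x) (zero_add 0)))
  congr 1
  apply Subtype.ext
  rw [kerMapOf_apply_val, extComplexPrecomp_f_apply]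
  exact (cyclesExtAddEquiv_precomp g I 0 0 1 (CochainComplex.next ℕ 0) _).symm

end Main

end AcyclicResolution

end Literature.Algebra.Homology

end
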